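import Mathlib
import HarnessLib
import Summits.HubbardSuperconductivity.HubbardSuperconductivity.Theorems.KLProgrammeKLRegimeEnginePairTransferOutClassFrameShiftSizes
import Summits.HubbardSuperconductivity.HubbardSuperconductivity.Theorems.KLProgrammeKLRegimeTwoVolumeLastScaleFrameExact
import Summits.HubbardSuperconductivity.HubbardSuperconductivity.Theorems.KLProgrammeKLRegimeSplitThermalLayer
import Summits.HubbardSuperconductivity.HubbardSuperconductivity.Theorems.KLProgrammeKLRegimeSplitLegCount

/-!
# Route `KLProgramme` — ENGINE item stmt-HubbardSuperconductivity-20437 `KLRegimeEngineV17F2`, stub (c) value lane: `hshift` in the KL regime (`n ≤ n_β`, the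
# frequency floor discharged) and AT THE LAST INDEX `n = n_β + 1` (the mismatch covariance vanishes: ONLY the first-order dressing share survives)
# (cell gate-hubbard-kl, seat p2 g24; sequel of `…OutClassFrameShiftSizes`)

* §1 **`hshift_of_sizes_klRegime`** — `hshift_of_sizes` for `1 ≤ n ≤ nScales β` with the hypothesis `π ≤ Λₙ·β` DISCHARGED from `klBetaMin ≤ β`
  (`π/β ≤ Λ_{n_β} ≤ Λₙ`, `klth_pi_div_le_klScale_nScales` + `klld_klScale_anti`).
* §2 the LAST INDEX `n = n_β + 1` (`Λ_{n_β+1} < π/β`, k3c4-p2's «frame change exact below temperature», …TwoVolumeLastScaleFrameExact): the single-scale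
  mismatch covariance vanishes identically, so `T_n(K₂)₄(X) − T_n(K₁)₄(X) = (Π_i m(X_i) − 1)·T_n(K₁)₄(X)` EXACTLY (`kernel_four_klEffectiveAction_frame_sub_eq_lastScale`)
  — no interpolation, no `Z_t`, no six-, two- or four-leg sizes along a path; with the dressing priced (`δ ≤ 600fd/Λ`) and `T(K₁)₄ = (Πm)⁻¹·T(K₂)₄`
  (`‖(Πm)⁻¹‖ ≤ (1+2fd/Λ)⁴ ≤ 81/16`): **`norm_klPairAmplitude_frame_sub_le_lastScale`**: `‖𝒞_n[K₂] − 𝒞_n[K₁]‖ ≤ (6075/2)·‖𝒞_n[K₂](Q;k,k′)‖/Λₙ·frameDist K₂ K₁`,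
  and **`hshift_of_size_lastScale`**: the `hshift` binder at `n = n_β + 1` from the history, `IsUnit Z(K_n)` at scale `n`, and ONE size
  `‖𝒞ₙ[Kₙ](Qm,x,y)‖ ≤ a·Klam·|U|` (`a ≤ 2²⁸`) — via `hshift_of_frameResponse_orders_hist` with `ℓ₂ = 0`.
Composition + arithmetic; no definitions; nothing about the sizes is asserted; nothing here asserts (c), any stub of 20437, K3, the margin or superconductivity.
References: BGM 2006 §2.3 (2.21)–(2.24) [cite: BenfattoGiulianiMastropietro2006]; Salmhofer 1999 §4.2.3 [cite: Salmhofer1999].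
-/

noncomputable section

namespace Summit.HubbardSuperconductivity.HubbardSuperconductivity.Theorems.KLRegimeSplit

set_option linter.dupNamespace false -- summit = problem name (single-conjunct summit), D-0017

open Real Finset Literature.MathematicalPhysics.QuantumLattice Literature.Probability.LatticeModels GrassmannAlgebra
open Summit.HubbardSuperconductivity.HubbardSuperconductivity.Theorems.KLProgrammeLegKernels
open Summit.HubbardSuperconductivity.HubbardSuperconductivity.Theorems.EngineV8
open Summit.HubbardSuperconductivity.HubbardSuperconductivity.Theorems.TwoVolumeDefect
open Summit.HubbardSuperconductivity.HubbardSuperconductivity.Theorems.TwoPointAssembly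

section Model

variable {L M : ℕ} [NeZero L] [NeZero M] {G : GeoConsts} {P : SplitConsts} {Q : EngConsts} {R : RenConsts} {β U μ c : ℝ} {n : ℕ}

/-! ## §1 In the KL regime the frequency floor `π ≤ Λₙβ` is automatic -/

/-- `π ≤ Λₙ·β` for `n ≤ n_β` (`π/β ≤ Λ_{n_β} ≤ Λₙ`). -/
theorem pi_le_klScale_mul_beta (hβmin : klBetaMin ≤ β) (hn : n ≤ nScales β) : Real.pi ≤ klScale klE0 n * β := by
  have hβ0 : 0 < β := pos_of_klBetaMin_le hβmin
  have h := (klth_pi_div_le_klScale_nScales hβmin).trans (klld_klScale_anti hn)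
  rwa [div_le_iff₀ hβ0] at h

/-- **`hshift_of_sizes` IN THE KL REGIME** (`1 ≤ n ≤ nScales β`): the frequency-floor hypothesis is discharged from `klBetaMin ≤ β`; all other inputs as in
`hshift_of_sizes`. [cite: BenfattoGiulianiMastropietro2006, §2.3 (2.21)–(2.24), §3 (3.3)] -/
theorem hshift_of_sizes_klRegime (hβmin : klBetaMin ≤ β) (hnβ : n ≤ nScales β)
    (hhist : HistP klPredsV17F2 L M G P Q R β U μ 0 n) (hn1 : 1 ≤ n) (hP : P.WF) (hRW : R.WF)
    (hQ : (klEngQ8 P R).IsRaiseOf Q) (hU : 0 < U) (hU4 : U ≤ klEngU₀4 P R c) (hβ : 0 < β) {Qm x y : TorusSite 2 L}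
    (hZ₂ : effPartitionFn ℂ (normalCovariance L M (uvSymbolCT L M β μ (klFlowFrameU L M β U μ n) (klScale klE0 n)))
      (hubbardInteraction L M β U + counterQuadratic L M β (klFlowFrameU L M β U μ n)) ≠ 0)
    {s₀ s₁ : FreqMomentum L M × Fin 2 → ℂ} (hs₀ : s₀ = uvSymbolCT L M β μ (klFlowFrameU L M β U μ (n - 1)) (klScale klE0 n))
    (hs₁ : s₁ = fun ks => uvSymbolCT L M β μ (klFlowFrameU L M β U μ n) (klScale klE0 n) ks /
      (1 + uvSymbolCT L M β μ (klFlowFrameU L M β U μ n) (klScale klE0 n) ks *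
        (((fsub (klFlowFrameU L M β U μ n) (klFlowFrameU L M β U μ (n - 1))).eval (latticeMomentum L ks.1.2) / (β * (L : ℝ) ^ 2) : ℝ) : ℂ)))
    (hZ : ∀ t ∈ Set.Icc (0 : ℝ) 1, effPartitionFn ℂ (normalCovariance L M s₀ + ((t : ℂ)) • (normalCovariance L M s₁ - normalCovariance L M s₀))
      (hubbardInteraction L M β U + counterQuadratic L M β (klFlowFrameU L M β U μ (n - 1))) ≠ 0)
    {a n₆ s₂ n₄ Cb : ℝ} (ha0 : 0 ≤ a) (ha : a ≤ 2 ^ 28) (hn₆ : 0 ≤ n₆) (hs₂ : 0 ≤ s₂) (hn₄ : 0 ≤ n₄)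
    (hroom : 547400 * (8 / Real.pi * Cb * n₆ + 4 * s₂ * n₄) ≤ klHshiftC)
    (hC4 : ‖klPairAmplitude L M β U μ (klFlowFrameU L M β U μ n) n Qm x y‖ ≤ a * (P.Klam * |U|))
    (hN6 : ∀ t ∈ Set.Icc (0 : ℝ) 1, ∀ A : HubbardFieldIdx L M,
      ‖kernel ℂ (effAction ℂ (normalCovariance L M s₀ + ((t : ℂ)) • (normalCovariance L M s₁ - normalCovariance L M s₀))
        (hubbardInteraction L M β U + counterQuadratic L M β (klFlowFrameU L M β U μ (n - 1)))) 6
        (Fin.snoc (Fin.snoc ![(((omega0 M, y), 0), 0), ((((omega0 M).rev, Qm - y), 1), 0), ((((omega0 M).rev, Qm - x), 1), 1), (((omega0 M, x), 0), 1)] (A.1, 1 - A.2) : Fin 5 → HubbardFieldIdx L M) A)‖ ≤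
          n₆ * (P.Klam * U) ^ 2 / klScale klE0 n / (720 * (β * (L : ℝ) ^ 2) ^ 5))
    (hS : ∀ t ∈ Set.Icc (0 : ℝ) 1, ∀ i : Fin 4,
      |nambuXiCT L μ (klFlowFrameU L M β U μ (n - 1)) ((![(((omega0 M, y), 0), 0), ((((omega0 M).rev, Qm - y), 1), 0), ((((omega0 M).rev, Qm - x), 1), 1), (((omega0 M, x), 0), 1)] :
              Fin 4 → HubbardFieldIdx L M) i).1.1.2| < 5 * klScale klE0 n / 4 →
      ‖kernel ℂ (effAction ℂ (normalCovariance L M s₀ + ((t : ℂ)) • (normalCovariance L M s₁ - normalCovariance L M s₀))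
        (hubbardInteraction L M β U + counterQuadratic L M β (klFlowFrameU L M β U μ (n - 1)))) 2
        ![((((![(((omega0 M, y), 0), 0), ((((omega0 M).rev, Qm - y), 1), 0), ((((omega0 M).rev, Qm - x), 1), 1), (((omega0 M, x), 0), 1)] :
              Fin 4 → HubbardFieldIdx L M) i).1,
            1 - ((![(((omega0 M, y), 0), 0), ((((omega0 M).rev, Qm - y), 1), 0), ((((omega0 M).rev, Qm - x), 1), 1), (((omega0 M, x), 0), 1)] :
              Fin 4 → HubbardFieldIdx L M) i).2) : HubbardFieldIdx L M),
          (![(((omega0 M, y), 0), 0), ((((omega0 M).rev, Qm - y), 1), 0), ((((omega0 M).rev, Qm - x), 1), 1), (((omega0 M, x), 0), 1)] :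
              Fin 4 → HubbardFieldIdx L M) i]‖ ≤ s₂ * |U| * klScale klE0 n / (2 * (β * (L : ℝ) ^ 2)))
    (hN4 : ∀ t ∈ Set.Icc (0 : ℝ) 1,
      ‖kernel ℂ (effAction ℂ (normalCovariance L M s₀ + ((t : ℂ)) • (normalCovariance L M s₁ - normalCovariance L M s₀))
        (hubbardInteraction L M β U + counterQuadratic L M β (klFlowFrameU L M β U μ (n - 1)))) 4
        ![(((omega0 M, y), 0), 0), ((((omega0 M).rev, Qm - y), 1), 0), ((((omega0 M).rev, Qm - x), 1), 1), (((omega0 M, x), 0), 1)]‖ ≤ n₄ * (P.Klam * |U|) / (24 * (β * (L : ℝ) ^ 2) ^ 3))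
    (hband : (((Finset.univ.filter fun kv : TorusSite 2 L => |nambuXiCT L μ (klFlowFrameU L M β U μ (n - 1)) kv| < 5 * klScale klE0 n / 4).card : ℕ) : ℝ) ≤
      Cb * (L : ℝ) ^ 2 * klScale klE0 n) :
    ‖klPairAmplitude L M β U μ (klFlowFrameU L M β U μ n) n Qm x y - klPairAmplitude L M β U μ (klFlowFrameU L M β U μ (n - 1)) n Qm x y‖ ≤
      frameShiftBar P Q U n :=
  have hΛβ := pi_le_klScale_mul_beta hβmin hnβ
  hshift_of_sizes hhist hn1 hP hRW hQ hU hU4 hβ hZ₂ hs₀ hs₁ hZ ha0 ha hn₆ hs₂ hn₄ hroom hC4 hN6 hS hN4 hband hΛβ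

/-! ## §2 The last index `n = n_β + 1`: only the dressing share -/

/-- **At the last index the four-leg frame difference is PURE DRESSING**: `T(K₂)₄(X) − T(K₁)₄(X) = (Π_i m(X_i) − 1)·T(K₁)₄(X)` at `n = n_β + 1`
(`IsUnit Z(K₂)` at that scale; the chain has no four-leg kernel). [cite: BenfattoGiulianiMastropietro2006, §2.3 (2.21)–(2.24)] -/
theorem kernel_four_klEffectiveAction_frame_sub_eq_lastScale (hβ : 0 < β) (K₁ K₂ : TrigPolyC4v)
    (hZ₂ : IsUnit (effPartitionFn ℂ (normalCovariance L M (uvSymbolCT L M β μ K₂ (klScale klE0 (nScales β + 1))))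
      (hubbardInteraction L M β U + counterQuadratic L M β K₂)))
    (X : Fin 4 → HubbardFieldIdx L M) :
    kernel ℂ (klEffectiveAction L M β U μ K₂ klE0 (nScales β + 1)) 4 X - kernel ℂ (klEffectiveAction L M β U μ K₁ klE0 (nScales β + 1)) 4 X =
      ((∏ i : Fin 4, (1 + uvSymbolCT L M β μ K₂ (klScale klE0 (nScales β + 1)) (X i).1 *
            (((fsub K₂ K₁).eval (latticeMomentum L (X i).1.1.2) / (β * (L : ℝ) ^ 2) : ℝ) : ℂ))⁻¹) - 1) *
        kernel ℂ (klEffectiveAction L M β U μ K₁ klE0 (nScales β + 1)) 4 X := by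
  have hZ₁ := (isUnit_effPartitionFn_frame_iff_lastScale (L := L) (M := M) hβ U μ K₁ K₂).1 hZ₂
  rw [klEffectiveAction_frame_eq_chain_add_map_lastScale hβ U μ K₁ K₂ hZ₁, kernel_add,
    kernel_four_effAction_counterQuadratic_eq_zero hβ μ K₂ (fsub K₂ K₁) _ X, zero_add, kernel_map_mulLeft]
  ring

/-- **THE FRAME RESPONSE OF THE PAIR AMPLITUDE AT THE LAST INDEX**: for `frameDist K₂ K₁ ≤ Λ/4` (`Λ = Λ_{n_β+1}`) and `IsUnit Z(K₂)`,
`‖𝒞[K₂](Q;k,k′) − 𝒞[K₁](Q;k,k′)‖ ≤ (6075/2)·‖𝒞[K₂](Q;k,k′)‖/Λ·frameDist K₂ K₁` (dressing `≤ 600fd/Λ`, `‖(Πm)⁻¹‖ ≤ 81/16`).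
[cite: BenfattoGiulianiMastropietro2006, §2.3 (2.21)–(2.24)] -/
theorem norm_klPairAmplitude_frame_sub_le_lastScale (hβ : 0 < β) (K₁ K₂ : TrigPolyC4v)
    (hfd : frameDist K₂ K₁ ≤ klScale klE0 (nScales β + 1) / 4)
    (hZ₂ : IsUnit (effPartitionFn ℂ (normalCovariance L M (uvSymbolCT L M β μ K₂ (klScale klE0 (nScales β + 1))))
      (hubbardInteraction L M β U + counterQuadratic L M β K₂)))
    (Qm x y : TorusSite 2 L) :
    ‖klPairAmplitude L M β U μ K₂ (nScales β + 1) Qm x y - klPairAmplitude L M β U μ K₁ (nScales β + 1) Qm x y‖ ≤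
      6075 / 2 * ‖klPairAmplitude L M β U μ K₂ (nScales β + 1) Qm x y‖ / klScale klE0 (nScales β + 1) * frameDist K₂ K₁ := by
  have hΛ : 0 < klScale klE0 (nScales β + 1) := klth_klScale_pos _
  have hfd0 : 0 ≤ frameDist K₂ K₁ := frameDist_nonneg K₂ K₁
  set Λ := klScale klE0 (nScales β + 1) with hΛdef
  set X : Fin 4 → HubbardFieldIdx L M := ![(((omega0 M, y), 0), 0), ((((omega0 M).rev, Qm - y), 1), 0), ((((omega0 M).rev, Qm - x), 1), 1), (((omega0 M, x), 0), 1)] with hX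
  set z : Fin 4 → ℂ := fun i => 1 + uvSymbolCT L M β μ K₂ Λ (X i).1 *
      (((fsub K₂ K₁).eval (latticeMomentum L (X i).1.1.2) / (β * (L : ℝ) ^ 2) : ℝ) : ℂ) with hz
  have hz0 : ∀ i, z i ≠ 0 := fun i => one_add_uvSymbolCT_mul_ofReal_ne_zero hβ μ K₂ Λ _ (X i).1
  have hid := kernel_four_klEffectiveAction_frame_sub_eq_lastScale (L := L) (M := M) (U := U) (μ := μ) hβ K₁ K₂ hZ₂ X
  -- `T(K₁)₄ = (Π z)·T(K₂)₄`
  have hprod : (∏ i : Fin 4, (z i)⁻¹) * ∏ i : Fin 4, z i = 1 := by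
    rw [← Finset.prod_mul_distrib, Finset.prod_congr rfl fun i _ => inv_mul_cancel₀ (hz0 i), Finset.prod_const_one]
  have hT1 : kernel ℂ (klEffectiveAction L M β U μ K₁ klE0 (nScales β + 1)) 4 X =
      (∏ i : Fin 4, z i) * kernel ℂ (klEffectiveAction L M β U μ K₂ klE0 (nScales β + 1)) 4 X := by
    have h2 : kernel ℂ (klEffectiveAction L M β U μ K₂ klE0 (nScales β + 1)) 4 X =
        (∏ i : Fin 4, (z i)⁻¹) * kernel ℂ (klEffectiveAction L M β U μ K₁ klE0 (nScales β + 1)) 4 X := by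
      have := hid; rw [sub_eq_iff_eq_add] at this; rw [this]; ring
    rw [h2, ← mul_assoc, mul_comm (∏ i : Fin 4, z i), hprod, one_mul]
  have hDle : ∀ kv : TorusSite 2 L, |(fsub K₂ K₁).eval (latticeMomentum L kv)| ≤ frameDist K₂ K₁ := fun kv => by
    rw [eval_fsub]; exact abs_eval_sub_le_frameDist K₂ K₁ _
  have hzn : ‖∏ i : Fin 4, z i‖ ≤ (1 + 2 * frameDist K₂ K₁ / Λ) ^ 4 := by
    calc ‖∏ i : Fin 4, z i‖ ≤ ∏ i : Fin 4, ‖z i‖ := Finset.norm_prod_le _ _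
      _ ≤ ∏ _i : Fin 4, (1 + 2 * frameDist K₂ K₁ / Λ) :=
          Finset.prod_le_prod (fun i _ => norm_nonneg _) fun i _ => norm_one_add_uvSymbolCT_mul_le hβ μ K₁ K₂ hΛ (X i).1 (hDle _)
      _ = (1 + 2 * frameDist K₂ K₁ / Λ) ^ 4 := by rw [Finset.prod_const, Finset.card_univ, Fintype.card_fin]
  have h81 := one_add_two_mul_div_pow_four_le hΛ hfd0 hfd
  have hm := norm_prod_dressing_sub_one_le hβ μ K₁ K₂ hΛ hfd X
  -- kernel-level bound
  have hker : ‖kernel ℂ (klEffectiveAction L M β U μ K₂ klE0 (nScales β + 1)) 4 X -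
      kernel ℂ (klEffectiveAction L M β U μ K₁ klE0 (nScales β + 1)) 4 X‖ ≤
      600 * frameDist K₂ K₁ / Λ * (81 / 16 * ‖kernel ℂ (klEffectiveAction L M β U μ K₂ klE0 (nScales β + 1)) 4 X‖) := by
    rw [hid, norm_mul, hT1, norm_mul]
    refine mul_le_mul hm (mul_le_mul_of_nonneg_right (hzn.trans h81) (norm_nonneg _)) (by positivity) (by positivity)
  rw [klPairAmplitude_eq_const_mul_kernel, klPairAmplitude_eq_const_mul_kernel, ← mul_sub, norm_mul, norm_mul, norm_pairAmplitude_const]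
  have hc3 : 0 ≤ 24 * (|β| * (L : ℝ) ^ 2) ^ 3 := by positivity
  calc 24 * (|β| * (L : ℝ) ^ 2) ^ 3 * ‖kernel ℂ (klEffectiveAction L M β U μ K₂ klE0 (nScales β + 1)) 4 X -
        kernel ℂ (klEffectiveAction L M β U μ K₁ klE0 (nScales β + 1)) 4 X‖
      ≤ 24 * (|β| * (L : ℝ) ^ 2) ^ 3 * (600 * frameDist K₂ K₁ / Λ * (81 / 16 * ‖kernel ℂ (klEffectiveAction L M β U μ K₂ klE0 (nScales β + 1)) 4 X‖)) :=
        mul_le_mul_of_nonneg_left hker hc3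
    _ = 6075 / 2 * (24 * (|β| * (L : ℝ) ^ 2) ^ 3 * ‖kernel ℂ (klEffectiveAction L M β U μ K₂ klE0 (nScales β + 1)) 4 X‖) / Λ * frameDist K₂ K₁ := by
        ring

/-- **THE `hshift` BINDER AT THE LAST INDEX `n = n_β + 1` FROM ONE SIZE**: history, stub binders, `IsUnit Z(K_n)` at scale `n`, and `‖𝒞ₙ[Kₙ](Qm,x,y)‖ ≤ a·Klam·|U|`
(`a ≤ 2²⁸`) ⟹ `‖𝒞ₙ[Kₙ](Qm,x,y) − 𝒞ₙ[Kₙ₋₁](Qm,x,y)‖ ≤ frameShiftBar P Q U n` — no path, no six-, two- or four-leg sizes (the mismatch covariance is zero below temperature).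
[cite: BenfattoGiulianiMastropietro2006, §2.3 (2.21)–(2.24)] -/
theorem hshift_of_size_lastScale (hhist : HistP klPredsV17F2 L M G P Q R β U μ 0 (nScales β + 1)) (hP : P.WF) (hRW : R.WF)
    (hQ : (klEngQ8 P R).IsRaiseOf Q) (hU : 0 < U) (hU4 : U ≤ klEngU₀4 P R c) (hβ : 0 < β) {Qm x y : TorusSite 2 L}
    (hZ₂ : IsUnit (effPartitionFn ℂ (normalCovariance L M (uvSymbolCT L M β μ (klFlowFrameU L M β U μ (nScales β + 1)) (klScale klE0 (nScales β + 1))))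
      (hubbardInteraction L M β U + counterQuadratic L M β (klFlowFrameU L M β U μ (nScales β + 1)))))
    {a : ℝ} (ha0 : 0 ≤ a) (ha : a ≤ 2 ^ 28)
    (hC4 : ‖klPairAmplitude L M β U μ (klFlowFrameU L M β U μ (nScales β + 1)) (nScales β + 1) Qm x y‖ ≤ a * (P.Klam * |U|)) :
    ‖klPairAmplitude L M β U μ (klFlowFrameU L M β U μ (nScales β + 1)) (nScales β + 1) Qm x y -
        klPairAmplitude L M β U μ (klFlowFrameU L M β U μ (nScales β + 1 - 1)) (nScales β + 1) Qm x y‖ ≤ frameShiftBar P Q U (nScales β + 1) := by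
  have hΛ : 0 < klScale klE0 (nScales β + 1) := klth_klScale_pos _
  have hKlam : 1 ≤ P.Klam := hP.1
  have hfd := frameDist_klFlowFrameU_le_klScale_div_four hhist (Nat.succ_pos _) hRW hU hU4
  rw [show nScales β + 1 - 1 = nScales β by omega] at hfd ⊢
  have hfd0 : 0 ≤ frameDist (klFlowFrameU L M β U μ (nScales β + 1)) (klFlowFrameU L M β U μ (nScales β)) := frameDist_nonneg _ _
  have h1 := norm_klPairAmplitude_frame_sub_le_lastScale (L := L) (M := M) (U := U) (μ := μ) hβ (klFlowFrameU L M β U μ (nScales β)) (klFlowFrameU L M β U μ (nScales β + 1)) hfd hZ₂ Qm x y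
  have hresp : ‖klPairAmplitude L M β U μ (klFlowFrameU L M β U μ (nScales β + 1)) (nScales β + 1) Qm x y - klPairAmplitude L M β U μ (klFlowFrameU L M β U μ (nScales β)) (nScales β + 1) Qm x y‖ ≤
      (6075 / 2 * (a * (P.Klam * |U|)) / klScale klE0 (nScales β + 1) + 0) * frameDist (klFlowFrameU L M β U μ (nScales β + 1)) (klFlowFrameU L M β U μ (nScales β)) := by
    rw [add_zero]
    refine h1.trans (mul_le_mul_of_nonneg_right ?_ hfd0)
    rw [div_le_div_iff_of_pos_right hΛ]
    exact mul_le_mul_of_nonneg_left hC4 (by norm_num)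
  have hℓ₁ : 6075 / 2 * (a * (P.Klam * |U|)) / klScale klE0 (nScales β + 1) ≤ 6075 / 2 * a * (P.Klam * |U|) / klScale klE0 (nScales β + 1) := by
    rw [mul_assoc]
  have hℓ₂ : (0 : ℝ) ≤ 0 * (P.Klam * U) ^ 2 / klScale klE0 (nScales β + 1) := by simp
  have hcℓ₁ : 6075 / 2 * a ≤ 2 ^ 40 := by nlinarith
  have hCR0 : 0 ≤ Q.CR := by
    have h := hshift_door_order2_klHshiftC_of_le_klEngU₀4 hRW hQ hU hU4
    have : 0 ≤ 1024 * klHshiftC * R.Gfr 0 * |U| := by have := klHshiftC_nonneg; have := hRW.2.2 0; positivity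
    linarith
  have hdoor₂ : 1024 * (0 : ℝ) * R.Gfr 0 * |U| ≤ Q.CR := by simpa using hCR0
  have h := hshift_of_frameResponse_orders_hist (n := nScales β + 1) hhist (Nat.succ_pos _) (hRW.2.2 0) (zero_le_one.trans hKlam)
    (by positivity) le_rfl (by rwa [show nScales β + 1 - 1 = nScales β by omega]) hℓ₁ hℓ₂ (hshift_door_order1_of_le hP hRW hQ hcℓ₁) hdoor₂
  rwa [show nScales β + 1 - 1 = nScales β by omega] at h

end Model

end Summit.HubbardSuperconductivity.HubbardSuperconductivity.Theorems.KLRegimeSplit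

end
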